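import Literature.NumberTheory.EllipticCurves.LiLiuTian2024.CongruentNumberRedeiFamilies
import Literature.NumberTheory.EllipticCurves.HeathBrown1994.CongruentTwoSelmerMonskyMatrix
import HarnessLib

/-!
# Sub-lane «bsd-p2»: RANK-ONE PAIRS `(E_n, ℓ)`, EVERY prime `ℓ`, closed in the kernel modulo two named
# facts — COMPOSITE Li–Liu–Tian rows by per-`n` Rédei certificates (p2-monsky-eng's `PilotRedei.lean`,
# batch `pilotR`, 11 twists; p2-lead QUEUE v3 (iv), ML-13 / T-48)

HONEST FRAMING (sub-lane «bsd-p2», run/shared/lean/b2b/bsd-rank1-residual/p2/, verbatim in every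
file): the target of record is the FULL Birch–Swinnerton-Dyer formula for EVERY analytic-rank `≤ 1`
`E/ℚ` at ALL primes INCLUDING `2`; the odd-prime class ledger is referee A's; the `2`-part is OPEN
(cells O1 = X5 ∖ CM and O12 = the CM corner) and under census by «bsd-p2». Census / instrument
output at `2` = EVIDENCE / conjecture items with held-out validation, NEVER a Literature fact;
certificates close PAIRS (one isogeny class, `p = 2`), never classes. This file asserts NO
arithmetic fact. CREDIT: GENERATED by p2-monsky-eng (`redei_cert_gen_v3.py`, `PilotRedei.lean`, farm
rc 0); the typer (one writer of `P2/**`) places it with this header. For each listed square-free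
`n = q₁⋯q_k ≡ 5 (mod 8)` with every `qᵢ ≡ 1 (mod 4)` the kernel DECIDES, on the tree's computable Rédei
matrix of `ℚ(√−n)` (Li–Ma 2008 orientation; `RedeiReichardt.redeiMatrix`, p319707), that its kernel
has exactly `2` elements (`rank RM = t − 1`, i.e. `4`-rank `0`: "no ideal class of order `4`"), and
concludes `BSD(E_n, ℓ)` for every prime `ℓ` (rank one, `#Ш` as predicted) through Li–Liu–Tian 2024
Thm 1.2 (lit's `forall_bsdp_congruentNumberCurve_of_thm12`) — MODULO the two named journal facts
carried as binders: Rédei–Reichardt (`hR`) and Li–Liu–Tian Thm 1.2 (`h12`,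
`LiLiuTian2024.thm12_bsd_congruentNumberCurve`). §0 = eng's per-`n` door (prime tuple `(2, q₁, …, q_k)`
of `D = −4n`; membership lemmas); §1 = the 11 rows of MONSKY-TABLE v1.1 door `LLT24-1.2:r4:2auth`,
`k ≥ 3` (n = 2405 … 2 996 045, outside the `U_CN` range; the in-range LLT rows are
`P2/CongruentNumberPairsAtTwoLLT.lean`, p321642), kernel count by `decide +kernel` (≤ 25 per file,
T-45). Pairs inside the OPEN cell `openO12` closed by a PRINTED theorem; they close no class.
Nothing booked; no mark moved. Unit `b2b-bsdres-p2-typer` GEN 4; NEW file.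

References: [LiLiuTian2024] Thm 1.2; [LiMa2008] Thm 0.4; [Miller2011LMS] Def 1.1;
HOME/p2/monsky/eng/lean/gen3/README.md §3; HOME/p2/LEAD-OKS.md ML-13, T-48.
-/

open Matrix WeierstrassCurve Literature.NumberTheory.EllipticCurves
  Literature.NumberTheory.EllipticCurves.LiLiuTian2024 Literature.NumberTheory.EllipticCurves.HeathBrown1994
  Literature.NumberTheory.QuadraticFields.RedeiReichardt

set_option autoImplicit false

namespace Summit.BirchSwinnertonDyer.Rank1Residual.P2

/-! ## §0 The per-n door (proved once; candidate for the typer's / lit's door file) -/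

section RedeiDoor

variable {k : ℕ}

/-- The prime tuple `(2, q₁, …, q_k)` of `D = −4n` is a tuple of primes when the `qᵢ` are. [cite: LiMa2008, Lemma 0.1 (p. 279)] -/
theorem prime_vecCons_two (q : Fin k → ℕ) (hq : ∀ i, (q i).Prime) :
    ∀ i, (Matrix.vecCons 2 q i).Prime := by
  refine Fin.cases ?_ ?_
  · simpa using Nat.prime_two
  · intro i; simpa using hq i

/-- … and injective when the `qᵢ` are distinct and odd. [cite: LiMa2008, Lemma 0.1 (p. 279)] -/
theorem injective_vecCons_two (q : Fin k → ℕ) (hinj : Function.Injective q) (h1 : ∀ i, q i % 4 = 1) :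
    Function.Injective (Matrix.vecCons 2 q) := by
  refine Fin.cons_injective_iff.mpr ⟨?_, hinj⟩
  rintro ⟨i, hi⟩
  have := h1 i
  omega

/-- `∏ (2, q₁, …, q_k) = 2n` — the Rédei–Reichardt door's product condition for `n ≡ 1 (mod 4)`. [cite: LiMa2008, Lemma 0.1 (p. 279)] -/
theorem prod_vecCons_two (q : Fin k → ℕ) {n : ℕ} (hn : ∏ i, q i = n) (h8 : n % 8 = 5) :
    ∏ i, Matrix.vecCons 2 q i = if n % 4 = 1 then 2 * n else n := by
  rw [if_pos (by omega), Fin.prod_univ_succ]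
  simp [hn]

/-- Every prime factor of `∏ qᵢ` is one of the `qᵢ`, hence `≡ 1 (mod 4)`. [cite: LiLiuTian2024, Thm. 1.2 (hypothesis: all prime factors ≡ 1 (mod 4))] -/
theorem prime_dvd_prod_mod_four (q : Fin k → ℕ) (hq : ∀ i, (q i).Prime) (h1 : ∀ i, q i % 4 = 1) :
    ∀ r : ℕ, r.Prime → r ∣ ∏ i, q i → r % 4 = 1 := by
  intro r hr hdvd
  obtain ⟨i, -, hi⟩ := (Nat.Prime.prime hr).exists_mem_finset_dvd hdvd
  rw [(Nat.prime_dvd_prime_iff_eq hr (hq i)).mp hi]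
  exact h1 i

/-- **JOURNAL door D-CM-1 (composite Li–Liu–Tian rows), per-n shape**: for `n = q₁⋯q_k ≡ 5 (mod 8)` with distinct
primes `qᵢ ≡ 1 (mod 4)`, a Rédei kernel of size `2` for the tuple `(2, q₁, …, q_k)` (decidable) gives — modulo
Rédei–Reichardt (`hR`) and Li–Liu–Tian 2024 Thm. 1.2 (`h12`) — `BSD(E_n, ℓ)` for every prime `ℓ`.
[cite: LiLiuTian2024, Thm. 1.2] [cite: LiMa2008, Thm. 0.4 (p. 280)] [cite: Miller2011LMS, §1 and Def. 1.1] -/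
theorem forall_bsdp_congruentNumberCurve_of_redei_card_ker (hR : redeiReichardt_fourTwoCard_classGroup)
    (h12 : thm12_bsd_congruentNumberCurve) (q : Fin k → ℕ) (hq : ∀ i, (q i).Prime)
    (hinj : Function.Injective q) (h1 : ∀ i, q i % 4 = 1) {n : ℕ} (hn : ∏ i, q i = n) (h8 : n % 8 = 5)
    (hker : Fintype.card {v : Fin (k + 1) → ZMod 2 // redeiMatrix n (Matrix.vecCons 2 q) *ᵥ v = 0} = 2)
    (ℓ : ℕ) (hℓ : ℓ.Prime) : BSDp (congruentNumberCurve n) ℓ := by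
  have hsq : Squarefree n := hn ▸ squarefree_prod_of_injective q hq hinj
  haveI := isElliptic_congruentNumberCurve (Squarefree.ne_zero hsq)
  haveI := isGloballyMinimal_congruentNumberCurve hsq
  refine forall_bsdp_congruentNumberCurve_of_thm12 h12 hsq h8 (hn ▸ prime_dvd_prod_mod_four q hq h1) ?_ ℓ hℓ
  exact noIdealClassOfOrderFour_of_card_ker hR (prime_vecCons_two q hq) (injective_vecCons_two q hinj h1)
    (prod_vecCons_two q hn h8) hker

/-- The same door concluding RANK ∧ SHAFIN ∧ LEAD and `rank = r_an = 1`. [cite: LiLiuTian2024, Thm. 1.2] [cite: LiMa2008, Thm. 0.4 (p. 280)] -/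
theorem bsd_congruentNumberCurve_of_redei_card_ker (hR : redeiReichardt_fourTwoCard_classGroup)
    (h12 : thm12_bsd_congruentNumberCurve) (q : Fin k → ℕ) (hq : ∀ i, (q i).Prime)
    (hinj : Function.Injective q) (h1 : ∀ i, q i % 4 = 1) {n : ℕ} (hn : ∏ i, q i = n) (h8 : n % 8 = 5)
    (hker : Fintype.card {v : Fin (k + 1) → ZMod 2 // redeiMatrix n (Matrix.vecCons 2 q) *ᵥ v = 0} = 2) :
    haveI := isElliptic_congruentNumberCurve (Squarefree.ne_zero (hn ▸ squarefree_prod_of_injective q hq hinj))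
    haveI := isGloballyMinimal_congruentNumberCurve (hn ▸ squarefree_prod_of_injective q hq hinj)
    (congruentNumberCurve n).mordellWeilRank = 1 ∧ (congruentNumberCurve n).analyticRank = 1 ∧
      (congruentNumberCurve n).BSDTriple :=
  bsd_congruentNumberCurve_of_thm12 h12 (hn ▸ squarefree_prod_of_injective q hq hinj) h8
    (hn ▸ prime_dvd_prod_mod_four q hq h1)
    (noIdealClassOfOrderFour_of_card_ker hR (prime_vecCons_two q hq) (injective_vecCons_two q hinj h1)
      (prod_vecCons_two q hn h8) hker)

end RedeiDoor

/-! ## §1 Instances (batch `pilotR`) -/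

/-- `n = 2405` = 5 · 13 · 37 (`k = 3`, `n ≡ 5 (mod 8)`, all `qᵢ ≡ 1 (mod 4)`): the Rédei matrix of `ℚ(√−2405)` on the primes `(2, 5, 13, 37)` has rows `1111;0011;0101;0110` and a `2`-element kernel (`r₄ = 0`), decided in the kernel ⇒ `BSD(E_{2405}, ℓ)` for every prime `ℓ` modulo Rédei–Reichardt (`hR`) + Li–Liu–Tian Thm 1.2 (`h12`). [cite: LiLiuTian2024, Thm. 1.2] [cite: LiMa2008, Thm. 0.4 (p. 280)] [cite: Miller2011LMS, Def. 1.1] -/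
theorem forall_bsdp_congruentNumberCurve_2405 (hR : redeiReichardt_fourTwoCard_classGroup)
    (h12 : thm12_bsd_congruentNumberCurve) (ℓ : ℕ) (hℓ : ℓ.Prime) : BSDp (congruentNumberCurve 2405) ℓ :=
  forall_bsdp_congruentNumberCurve_of_redei_card_ker hR h12 ![5, 13, 37]
    (by intro i; fin_cases i <;> norm_num) (by decide) (by decide) (by simp [Fin.prod_univ_succ]) (by decide)
    (by decide +kernel) ℓ hℓ

/-- `n = 3445` = 5 · 13 · 53 (`k = 3`, `n ≡ 5 (mod 8)`, all `qᵢ ≡ 1 (mod 4)`): the Rédei matrix of `ℚ(√−3445)` on the primes `(2, 5, 13, 53)` has rows `1111;0011;0110;0101` and a `2`-element kernel (`r₄ = 0`), decided in the kernel ⇒ `BSD(E_{3445}, ℓ)` for every prime `ℓ` modulo Rédei–Reichardt (`hR`) + Li–Liu–Tian Thm 1.2 (`h12`). [cite: LiLiuTian2024, Thm. 1.2] [cite: LiMa2008, Thm. 0.4 (p. 280)] [cite: Miller2011LMS, Def. 1.1] -/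
theorem forall_bsdp_congruentNumberCurve_3445 (hR : redeiReichardt_fourTwoCard_classGroup)
    (h12 : thm12_bsd_congruentNumberCurve) (ℓ : ℕ) (hℓ : ℓ.Prime) : BSDp (congruentNumberCurve 3445) ℓ :=
  forall_bsdp_congruentNumberCurve_of_redei_card_ker hR h12 ![5, 13, 53]
    (by intro i; fin_cases i <;> norm_num) (by decide) (by decide) (by simp [Fin.prod_univ_succ]) (by decide)
    (by decide +kernel) ℓ hℓ

/-- `n = 3485` = 5 · 17 · 41 (`k = 3`, `n ≡ 5 (mod 8)`, all `qᵢ ≡ 1 (mod 4)`): the Rédei matrix of `ℚ(√−3485)` on the primes `(2, 5, 17, 41)` has rows `1100;0110;0101;0011` and a `2`-element kernel (`r₄ = 0`), decided in the kernel ⇒ `BSD(E_{3485}, ℓ)` for every prime `ℓ` modulo Rédei–Reichardt (`hR`) + Li–Liu–Tian Thm 1.2 (`h12`). [cite: LiLiuTian2024, Thm. 1.2] [cite: LiMa2008, Thm. 0.4 (p. 280)] [cite: Miller2011LMS, Def. 1.1] -/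
theorem forall_bsdp_congruentNumberCurve_3485 (hR : redeiReichardt_fourTwoCard_classGroup)
    (h12 : thm12_bsd_congruentNumberCurve) (ℓ : ℕ) (hℓ : ℓ.Prime) : BSDp (congruentNumberCurve 3485) ℓ :=
  forall_bsdp_congruentNumberCurve_of_redei_card_ker hR h12 ![5, 17, 41]
    (by intro i; fin_cases i <;> norm_num) (by decide) (by decide) (by simp [Fin.prod_univ_succ]) (by decide)
    (by decide +kernel) ℓ hℓ

/-- `n = 2998645` = 5 · 13 · 46133 (`k = 3`, `n ≡ 5 (mod 8)`, all `qᵢ ≡ 1 (mod 4)`): the Rédei matrix of `ℚ(√−2998645)` on the primes `(2, 5, 13, 46133)` has rows `1111;0011;0110;0101` and a `2`-element kernel (`r₄ = 0`), decided in the kernel ⇒ `BSD(E_{2998645}, ℓ)` for every prime `ℓ` modulo Rédei–Reichardt (`hR`) + Li–Liu–Tian Thm 1.2 (`h12`). [cite: LiLiuTian2024, Thm. 1.2] [cite: LiMa2008, Thm. 0.4 (p. 280)] [cite: Miller2011LMS, Def. 1.1] -/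
theorem forall_bsdp_congruentNumberCurve_2998645 (hR : redeiReichardt_fourTwoCard_classGroup)
    (h12 : thm12_bsd_congruentNumberCurve) (ℓ : ℕ) (hℓ : ℓ.Prime) : BSDp (congruentNumberCurve 2998645) ℓ :=
  forall_bsdp_congruentNumberCurve_of_redei_card_ker hR h12 ![5, 13, 46133]
    (by intro i; fin_cases i <;> norm_num) (by decide) (by decide) (by simp [Fin.prod_univ_succ]) (by decide)
    (by decide +kernel) ℓ hℓ

/-- `n = 2996045` = 5 · 13 · 46093 (`k = 3`, `n ≡ 5 (mod 8)`, all `qᵢ ≡ 1 (mod 4)`): the Rédei matrix of `ℚ(√−2996045)` on the primes `(2, 5, 13, 46093)` has rows `1111;0011;0101;0110` and a `2`-element kernel (`r₄ = 0`), decided in the kernel ⇒ `BSD(E_{2996045}, ℓ)` for every prime `ℓ` modulo Rédei–Reichardt (`hR`) + Li–Liu–Tian Thm 1.2 (`h12`). [cite: LiLiuTian2024, Thm. 1.2] [cite: LiMa2008, Thm. 0.4 (p. 280)] [cite: Miller2011LMS, Def. 1.1] -/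
theorem forall_bsdp_congruentNumberCurve_2996045 (hR : redeiReichardt_fourTwoCard_classGroup)
    (h12 : thm12_bsd_congruentNumberCurve) (ℓ : ℕ) (hℓ : ℓ.Prime) : BSDp (congruentNumberCurve 2996045) ℓ :=
  forall_bsdp_congruentNumberCurve_of_redei_card_ker hR h12 ![5, 13, 46093]
    (by intro i; fin_cases i <;> norm_num) (by decide) (by decide) (by simp [Fin.prod_univ_succ]) (by decide)
    (by decide +kernel) ℓ hℓ

/-- `n = 32045` = 5 · 13 · 17 · 29 (`k = 4`, `n ≡ 5 (mod 8)`, all `qᵢ ≡ 1 (mod 4)`): the Rédei matrix of `ℚ(√−32045)` on the primes `(2, 5, 13, 17, 29)` has rows `11101;00110;01100;01001;00011` and a `2`-element kernel (`r₄ = 0`), decided in the kernel ⇒ `BSD(E_{32045}, ℓ)` for every prime `ℓ` modulo Rédei–Reichardt (`hR`) + Li–Liu–Tian Thm 1.2 (`h12`). [cite: LiLiuTian2024, Thm. 1.2] [cite: LiMa2008, Thm. 0.4 (p. 280)] [cite: Miller2011LMS, Def. 1.1] -/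
theorem forall_bsdp_congruentNumberCurve_32045 (hR : redeiReichardt_fourTwoCard_classGroup)
    (h12 : thm12_bsd_congruentNumberCurve) (ℓ : ℕ) (hℓ : ℓ.Prime) : BSDp (congruentNumberCurve 32045) ℓ :=
  forall_bsdp_congruentNumberCurve_of_redei_card_ker hR h12 ![5, 13, 17, 29]
    (by intro i; fin_cases i <;> norm_num) (by decide) (by decide) (by simp [Fin.prod_univ_succ]) (by decide)
    (by decide +kernel) ℓ hℓ

/-- `n = 1262573` = 13 · 17 · 29 · 197 (`k = 4`, `n ≡ 5 (mod 8)`, all `qᵢ ≡ 1 (mod 4)`): the Rédei matrix of `ℚ(√−1262573)` on the primes `(2, 13, 17, 29, 197)` has rows `11011;01001;00011;00110;01100` and a `2`-element kernel (`r₄ = 0`), decided in the kernel ⇒ `BSD(E_{1262573}, ℓ)` for every prime `ℓ` modulo Rédei–Reichardt (`hR`) + Li–Liu–Tian Thm 1.2 (`h12`). [cite: LiLiuTian2024, Thm. 1.2] [cite: LiMa2008, Thm. 0.4 (p. 280)] [cite: Miller2011LMS, Def. 1.1] -/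
theorem forall_bsdp_congruentNumberCurve_1262573 (hR : redeiReichardt_fourTwoCard_classGroup)
    (h12 : thm12_bsd_congruentNumberCurve) (ℓ : ℕ) (hℓ : ℓ.Prime) : BSDp (congruentNumberCurve 1262573) ℓ :=
  forall_bsdp_congruentNumberCurve_of_redei_card_ker hR h12 ![13, 17, 29, 197]
    (by intro i; fin_cases i <;> norm_num) (by decide) (by decide) (by simp [Fin.prod_univ_succ]) (by decide)
    (by decide +kernel) ℓ hℓ

/-- `n = 2897765` = 5 · 13 · 109 · 409 (`k = 4`, `n ≡ 5 (mod 8)`, all `qᵢ ≡ 1 (mod 4)`): the Rédei matrix of `ℚ(√−2897765)` on the primes `(2, 5, 13, 109, 409)` has rows `11110;01100;01111;00110;00101` and a `2`-element kernel (`r₄ = 0`), decided in the kernel ⇒ `BSD(E_{2897765}, ℓ)` for every prime `ℓ` modulo Rédei–Reichardt (`hR`) + Li–Liu–Tian Thm 1.2 (`h12`). [cite: LiLiuTian2024, Thm. 1.2] [cite: LiMa2008, Thm. 0.4 (p. 280)] [cite: Miller2011LMS, Def. 1.1] -/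
theorem forall_bsdp_congruentNumberCurve_2897765 (hR : redeiReichardt_fourTwoCard_classGroup)
    (h12 : thm12_bsd_congruentNumberCurve) (ℓ : ℕ) (hℓ : ℓ.Prime) : BSDp (congruentNumberCurve 2897765) ℓ :=
  forall_bsdp_congruentNumberCurve_of_redei_card_ker hR h12 ![5, 13, 109, 409]
    (by intro i; fin_cases i <;> norm_num) (by decide) (by decide) (by simp [Fin.prod_univ_succ]) (by decide)
    (by decide +kernel) ℓ hℓ

/-- `n = 1313845` = 5 · 13 · 17 · 29 · 41 (`k = 5`, `n ≡ 5 (mod 8)`, all `qᵢ ≡ 1 (mod 4)`): the Rédei matrix of `ℚ(√−1313845)` on the primes `(2, 5, 13, 17, 29, 41)` has rows `111010;001100;010001;010111;000101;001111` and a `2`-element kernel (`r₄ = 0`), decided in the kernel ⇒ `BSD(E_{1313845}, ℓ)` for every prime `ℓ` modulo Rédei–Reichardt (`hR`) + Li–Liu–Tian Thm 1.2 (`h12`). [cite: LiLiuTian2024, Thm. 1.2] [cite: LiMa2008, Thm. 0.4 (p. 280)] [cite: Miller2011LMS, Def. 1.1] -/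
theorem forall_bsdp_congruentNumberCurve_1313845 (hR : redeiReichardt_fourTwoCard_classGroup)
    (h12 : thm12_bsd_congruentNumberCurve) (ℓ : ℕ) (hℓ : ℓ.Prime) : BSDp (congruentNumberCurve 1313845) ℓ :=
  forall_bsdp_congruentNumberCurve_of_redei_card_ker hR h12 ![5, 13, 17, 29, 41]
    (by intro i; fin_cases i <;> norm_num) (by decide) (by decide) (by simp [Fin.prod_univ_succ]) (by decide)
    (by decide +kernel) ℓ hℓ

/-- `n = 2984605` = 5 · 13 · 17 · 37 · 73 (`k = 5`, `n ≡ 5 (mod 8)`, all `qᵢ ≡ 1 (mod 4)`): the Rédei matrix of `ℚ(√−2984605)` on the primes `(2, 5, 13, 17, 37, 73)` has rows `111010;001111;011011;010111;011110;011101` and a `2`-element kernel (`r₄ = 0`), decided in the kernel ⇒ `BSD(E_{2984605}, ℓ)` for every prime `ℓ` modulo Rédei–Reichardt (`hR`) + Li–Liu–Tian Thm 1.2 (`h12`). [cite: LiLiuTian2024, Thm. 1.2] [cite: LiMa2008, Thm. 0.4 (p. 280)] [cite: Miller2011LMS, Def. 1.1] -/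
theorem forall_bsdp_congruentNumberCurve_2984605 (hR : redeiReichardt_fourTwoCard_classGroup)
    (h12 : thm12_bsd_congruentNumberCurve) (ℓ : ℕ) (hℓ : ℓ.Prime) : BSDp (congruentNumberCurve 2984605) ℓ :=
  forall_bsdp_congruentNumberCurve_of_redei_card_ker hR h12 ![5, 13, 17, 37, 73]
    (by intro i; fin_cases i <;> norm_num) (by decide) (by decide) (by simp [Fin.prod_univ_succ]) (by decide)
    (by decide +kernel) ℓ hℓ

-- n = 205: Rédei kernel has 4 elements (r4 = 1) — not a member, skipped

/-- `n = 85` = 5 · 17 (`k = 2`, `n ≡ 5 (mod 8)`, all `qᵢ ≡ 1 (mod 4)`): the Rédei matrix of `ℚ(√−85)` on the primes `(2, 5, 17)` has rows `110;011;011` and a `2`-element kernel (`r₄ = 0`), decided in the kernel ⇒ `BSD(E_{85}, ℓ)` for every prime `ℓ` modulo Rédei–Reichardt (`hR`) + Li–Liu–Tian Thm 1.2 (`h12`). [cite: LiLiuTian2024, Thm. 1.2] [cite: LiMa2008, Thm. 0.4 (p. 280)] [cite: Miller2011LMS, Def. 1.1] -/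
theorem forall_bsdp_congruentNumberCurve_85 (hR : redeiReichardt_fourTwoCard_classGroup)
    (h12 : thm12_bsd_congruentNumberCurve) (ℓ : ℕ) (hℓ : ℓ.Prime) : BSDp (congruentNumberCurve 85) ℓ :=
  forall_bsdp_congruentNumberCurve_of_redei_card_ker hR h12 ![5, 17]
    (by intro i; fin_cases i <;> norm_num) (by decide) (by decide) (by simp [Fin.prod_univ_succ]) (by decide)
    (by decide +kernel) ℓ hℓ

/-- **ROLL-UP (batch `pilotR`)**: `BSD(E_n, ℓ)` for every listed `n` (11 rank-one twists) and every prime `ℓ`, modulo the two named facts. [cite: LiLiuTian2024, Thm. 1.2] [cite: Miller2011LMS, Def. 1.1] -/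
theorem forall_bsdp_congruentNumberCurve_of_mem_lltList_pilotR (hR : redeiReichardt_fourTwoCard_classGroup)
    (h12 : thm12_bsd_congruentNumberCurve) :
    ∀ n ∈ ([2405, 3445, 3485, 2998645, 2996045, 32045, 1262573, 2897765, 1313845, 2984605, 85] : List ℕ), ∀ ℓ : ℕ, ℓ.Prime → BSDp (congruentNumberCurve n) ℓ := by
  intro n hn
  simp only [List.mem_cons, List.not_mem_nil, or_false] at hn
  rcases hn with rfl | rfl | rfl | rfl | rfl | rfl | rfl | rfl | rfl | rfl | rfl
  exacts [forall_bsdp_congruentNumberCurve_2405 hR h12, forall_bsdp_congruentNumberCurve_3445 hR h12, forall_bsdp_congruentNumberCurve_3485 hR h12, forall_bsdp_congruentNumberCurve_2998645 hR h12, forall_bsdp_congruentNumberCurve_2996045 hR h12, forall_bsdp_congruentNumberCurve_32045 hR h12, forall_bsdp_congruentNumberCurve_1262573 hR h12, forall_bsdp_congruentNumberCurve_2897765 hR h12, forall_bsdp_congruentNumberCurve_1313845 hR h12, forall_bsdp_congruentNumberCurve_2984605 hR h12, forall_bsdp_congruentNumberCurve_85 hR h12]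

end Summit.BirchSwinnertonDyer.Rank1Residual.P2
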